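import Summits.AtomisticToContinuum.Crystallization.Theorems.FrustratedLawDichotomyStrainedPatchHomEntryFitHcpCentredRotSound
import Summits.AtomisticToContinuum.Crystallization.Theorems.FrustratedLawDichotomyStrainedPatchHomEntryLeafHTCross095B
import Summits.AtomisticToContinuum.Crystallization.Theorems.FrustratedLawDichotomyStrainedPatchHomEntryLeafHTCross090C

/-!
# ★★★★ THE CROSSOVER CELLS CLOSE END TO END AT ENTRY HALF-WIDTH `2⁻¹²` WITH ONE INNER LEAF of the centred rotated verdict
# (27623 `(H) HomFloor (1/625)`, hcp half; hand-1 g31; critic rows 1172 / 1175 «fresh-cert crossover cell @2⁻¹²», (β) «leaf wall»)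

decomp-a2c hand-1 g31 (crux `AperiodicFrustratedLawGap`, stmt-AtomisticToContinuum-27623).  Cells and certificates of `…HomEntryLeafHTCross090A/B` (`0.9 t_b`) and
`…Cross095A/B` (`0.95 t_b`, the crossover): entry half-width `2⁻¹²`, shuffle `1.25·10⁻³`, confined boxes `≈ (1.96, 2.48, 0.92)·10⁻³` / `(2.0, 2.5, 0.93)·10⁻³`.
Inner verdict = `…CentredRotSound.entryLeafOKHQDCR muRec q` (centred fit against the rotated pattern with the cell's quaternion payload `q`, else min-pairs, else
the quick verdict).  KERNEL (seat `work/ktree/ktree6.log`): the WHOLE confined box is ONE passing leaf at both cells (53 s / 52 s) — with the verdicts of record the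
`0.9` box needed > 64 leaves and the `0.95` cell was not closable at all (`…SlabExtremes`, `…Cross090C`).

* `qX95c`, `qX90c` — payloads (float-optimal rotations at the cell centres, quaternions `·2⁻²⁰`);
* `treeOKCR_X95`, `treeOKCR_X90` — KERNEL: `treeOK (slabOut ∨ entryLeafOKHQDCR muRec q) .leaf c (htWr p c w) = true`;
* ★★★★ `entryLeafOKHT5QDCR_X95`, `entryLeafOKHT5QDCR_X90` — `entryLeafOKHT5QDCR muRec q p .leaf c w = true`: the pruned analytic-slab leaf with the centred rotated
  inner verdict closes the `0.95 t_b` AND the `0.9 t_b` crossover cells at `U 2⁻¹²` END TO END with a ONE-LEAF inner tree (assembly by rewriting from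
  `htCertSide_X95` / `htCertSide_X90`); by `entryLeafOKHT5QDCR_sound` the hver conclusion holds on the whole cells.  (β): production slab leaf at the crossover
  = certificate side (≈ 400 s as 3 grouped facts) + ONE inner leaf (≈ 50 s).

Kernel definitions (payloads) + kernel facts + assembly; 0 sorry; standard axioms.  `--supports stmt-AtomisticToContinuum-27623`.
-/

namespace Summit.AtomisticToContinuum.Crystallization.Theorems.FrustratedLawDichotomyStrainedPatchHomEntryLeafHT

open Literature.Analysis.ValidatedNumerics.Numerics
open Summit.AtomisticToContinuum.Crystallization.Theorems.FrustratedLawDichotomyStrainedPatchHomCertTree (CertTree treeOK)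
open Summit.AtomisticToContinuum.Crystallization.Theorems.FrustratedLawDichotomyStrainedPatchHomEntryTable (muRec)
open Summit.AtomisticToContinuum.Crystallization.Theorems.FrustratedLawDichotomyStrainedPatchHomEntryFitHcpCentred (entryLeafOKHQDCR)

/-- Rotation payload of the `0.95 t_b` cell: the float-optimal rotation at the cell centre as a quaternion `(a, b, c, n)·2⁻²⁰` (mostly about `x`, ≈ 0.011 rad). -/
def qX95c : Fin 4 → ℤ := ![5828, 0, 0, 1049328]

/-- Rotation payload of the `0.9 t_b` cell (quaternion `·2⁻²⁰`, ≈ 0.010 rad about `x`). -/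
def qX90c : Fin 4 → ℤ := ![5397, 0, 0, 1049584]

set_option maxRecDepth 100000 in
set_option maxHeartbeats 4000000 in
/-- ★★★ KERNEL: ONE inner leaf of the pruned centred-rotated verdict closes the whole confined box of the `0.95 t_b` crossover cell. -/
theorem treeOKCR_X95 :
    treeOK (fun c' w' => slabOut pX95 cX95 wX c' w' || entryLeafOKHQDCR muRec qX95c c' w') CertTree.leaf cX95 (htWr pX95 cX95 wX) = true := by
  decide +kernel

set_option maxRecDepth 100000 in
set_option maxHeartbeats 4000000 in
/-- ★★★ KERNEL: the same at the `0.9 t_b` cell. -/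
theorem treeOKCR_X90 :
    treeOK (fun c' w' => slabOut pX90 cX90 wX c' w' || entryLeafOKHQDCR muRec qX90c c' w') CertTree.leaf cX90 (htWr pX90 cX90 wX) = true := by
  decide +kernel

/-- ★★★★ **THE `0.95 t_b` CROSSOVER CELL CLOSES END TO END AT `U 2⁻¹²` WITH A ONE-LEAF INNER TREE.** [assembly by rewriting] -/
theorem entryLeafOKHT5QDCR_X95 : entryLeafOKHT5QDCR muRec qX95c pX95 CertTree.leaf cX95 wX = true := by
  have h1 := htCertSide_X95
  have h2 := treeOKCR_X95
  unfold entryLeafOKHT5QDCR entryLeafOKHT5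
  rw [h1, h2]
  rfl

/-- ★★★★ **THE `0.9 t_b` CELL LIKEWISE.** [assembly by rewriting] -/
theorem entryLeafOKHT5QDCR_X90 : entryLeafOKHT5QDCR muRec qX90c pX90 CertTree.leaf cX90 wX = true := by
  have h1 := htCertSide_X90
  have h2 := treeOKCR_X90
  unfold entryLeafOKHT5QDCR entryLeafOKHT5
  rw [h1, h2]
  rfl

end Summit.AtomisticToContinuum.Crystallization.Theorems.FrustratedLawDichotomyStrainedPatchHomEntryLeafHT
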